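import Summits.CriticalPhenomena.PercolationContinuityZ3.Theorems.PercNearOneGluingNoHeavyPcintOSMMono
import HarnessLib

/-!
# PCINT lane, PHASE 4 (kernel second-moment oriented route), step 4: the Green's-function tail

Cell `prim-pcint`, seat `prim-pcint-1` (gen 13); memo `run/shared/lean/prim/pcint/T-FIBRE-ROUTE.md` §PHASE 4.

A closed-form, kernel-checkable bound for the Green's function `G = Σ_k u d k` of two independent oriented walks:

* `OSM.B_step` : for `d ≥ 5`, `q ↦ B d q · (q+1)²` is non-increasing (`B (q+1)/B q = ∏_{j<d} (qd+j+1)/((q+1)d)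
  ≤ exp(−(d−1)/(2(q+1))) ≤ exp(−2/(q+1)) ≤ ((q+1)/(q+2))²`, from `1 − t ≤ e^{−t}` and `1 + t ≤ e^t`);
* `OSM.sum_range_u_le` : for `d ≥ 5`, `q₀ ≥ 1` and every `N`,
  `Σ_{k<N} u d k ≤ Σ_{k<q₀d} u d k + d · B d q₀ · (q₀+1)² / q₀` (monotonicity of `u`, `u (qd) ≤ B q`, and the
  telescoping `Σ_{q ≥ q₀} 1/(q(q+1)) = 1/q₀`);
* `OSM.Gplus` : the resulting explicit bound, with the finite part in the kernel form `Mrec d k / d^{2k}`.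
-/

noncomputable section

namespace Summit.CriticalPhenomena.PercolationContinuityZ3.Theorems.Pcint.OSM

open Finset Nat

variable {d : ℕ}

/-! ### Decay of the balanced probability -/

/-- The ratio of consecutive balanced probabilities. -/
theorem B_succ (hd : 0 < d) (q : ℕ) :
    B d (q + 1) = B d q * ∏ j ∈ range d, (((q * d + (j + 1) : ℕ) : ℝ) / (((q + 1) * d : ℕ) : ℝ)) := by
  unfold B
  have hfac : (((q + 1) * d)! : ℝ) = ((q * d)! : ℝ) * ∏ j ∈ range d, ((q * d + (j + 1) : ℕ) : ℝ) := by
    have h := Nat.factorial_mul_ascFactorial (q * d) d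
    rw [Nat.ascFactorial_eq_prod_range] at h
    have e : (q + 1) * d = q * d + d := by ring
    rw [e, ← h]
    push_cast
    congr 1
    refine Finset.prod_congr rfl fun j _ => ?_
    ring
  have hq1 : (((q + 1)! : ℕ) : ℝ) = ((q : ℝ) + 1) * ((q ! : ℕ) : ℝ) := by
    rw [Nat.factorial_succ]; push_cast; ring
  rw [hfac, hq1, Finset.prod_div_distrib, Finset.prod_const, Finset.card_range]
  have hdpos : (0 : ℝ) < d := by exact_mod_cast hd
  have hqf : (0 : ℝ) < ((q ! : ℕ) : ℝ) := by exact_mod_cast Nat.factorial_pos _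
  have e2 : (d : ℝ) ^ ((q + 1) * d) = (d : ℝ) ^ (q * d) * (d : ℝ) ^ d := by rw [← pow_add]; ring_nf
  rw [e2]
  simp only [mul_pow, Nat.cast_mul, Nat.cast_add, Nat.cast_one]
  field_simp

/-- `Σ_{j<d} (d − 1 − j) = d(d−1)/2` over `ℝ`. -/
theorem sum_range_sub (d : ℕ) : ∑ j ∈ range d, ((d : ℝ) - 1 - j) = (d : ℝ) * ((d : ℝ) - 1) / 2 := by
  have h := Finset.sum_range_id_mul_two d
  have h' : ((∑ i ∈ range d, i : ℕ) : ℝ) * 2 = (d : ℝ) * ((d - 1 : ℕ) : ℝ) := by exact_mod_cast h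
  rw [Finset.sum_sub_distrib, Finset.sum_const, Finset.card_range, nsmul_eq_mul]
  push_cast at h' ⊢
  rcases Nat.eq_zero_or_pos d with hd | hd
  · subst hd; simp
  · rw [Nat.cast_sub hd] at h'
    push_cast at h'
    linarith

/-- **The ratio bound**: `∏_{j<d} (qd+j+1)/((q+1)d) ≤ exp(−(d−1)/(2(q+1)))`. -/
theorem prod_ratio_le (hd : 0 < d) (q : ℕ) :
    ∏ j ∈ range d, (((q * d + (j + 1) : ℕ) : ℝ) / (((q + 1) * d : ℕ) : ℝ)) ≤
      Real.exp (-(((d : ℝ) - 1) / (2 * ((q : ℝ) + 1)))) := by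
  have hdpos : (0 : ℝ) < d := by exact_mod_cast hd
  have hden : (0 : ℝ) < ((q : ℝ) + 1) * d := by positivity
  -- each factor is `1 - t_j ≤ exp (-t_j)`
  have hfac : ∀ j ∈ range d, (((q * d + (j + 1) : ℕ) : ℝ) / (((q + 1) * d : ℕ) : ℝ)) ≤
      Real.exp (-(((d : ℝ) - 1 - j) / (((q : ℝ) + 1) * d))) := by
    intro j _
    have e : (((q * d + (j + 1) : ℕ) : ℝ) / (((q + 1) * d : ℕ) : ℝ)) = 1 - ((d : ℝ) - 1 - j) / (((q : ℝ) + 1) * d) := by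
      push_cast; field_simp; ring
    rw [e]
    exact Real.one_sub_le_exp_neg _
  calc ∏ j ∈ range d, (((q * d + (j + 1) : ℕ) : ℝ) / (((q + 1) * d : ℕ) : ℝ))
      ≤ ∏ j ∈ range d, Real.exp (-(((d : ℝ) - 1 - j) / (((q : ℝ) + 1) * d))) :=
        Finset.prod_le_prod (fun j _ => by positivity) hfac
    _ = Real.exp (-(((d : ℝ) - 1) / (2 * ((q : ℝ) + 1)))) := by
        rw [← Real.exp_sum]
        congr 1
        rw [Finset.sum_neg_distrib, neg_inj, ← Finset.sum_div, sum_range_sub]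
        field_simp

/-- `exp(−2/(q+1)) ≤ ((q+1)/(q+2))²`. -/
theorem exp_le_ratio_sq (q : ℕ) : Real.exp (-(2 : ℝ) / ((q : ℝ) + 1)) ≤ (((q : ℝ) + 1) / ((q : ℝ) + 2)) ^ 2 := by
  have hq : (0 : ℝ) < (q : ℝ) + 1 := by positivity
  have h1 : ((q : ℝ) + 2) / ((q : ℝ) + 1) ≤ Real.exp (1 / ((q : ℝ) + 1)) := by
    have := Real.add_one_le_exp (1 / ((q : ℝ) + 1))
    rw [show ((q : ℝ) + 2) / ((q : ℝ) + 1) = 1 / ((q : ℝ) + 1) + 1 by field_simp; ring]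
    exact this
  have h2 : Real.exp (-(1 : ℝ) / ((q : ℝ) + 1)) ≤ ((q : ℝ) + 1) / ((q : ℝ) + 2) := by
    rw [neg_div, Real.exp_neg]
    rw [inv_le_comm₀ (Real.exp_pos _) (by positivity), inv_div]
    exact h1
  have e : Real.exp (-(2 : ℝ) / ((q : ℝ) + 1)) = Real.exp (-(1 : ℝ) / ((q : ℝ) + 1)) ^ 2 := by
    rw [sq, ← Real.exp_add]; congr 1; ring
  rw [e]
  exact pow_le_pow_left₀ (Real.exp_pos _).le h2 2

/-- **One step of the decay**: for `d ≥ 5`, `B (q+1) · (q+2)² ≤ B q · (q+1)²`. -/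
theorem B_step (hd : 5 ≤ d) (q : ℕ) : B d (q + 1) * ((q : ℝ) + 2) ^ 2 ≤ B d q * ((q : ℝ) + 1) ^ 2 := by
  have hd0 : 0 < d := by omega
  have hB := B_pos hd0 q
  rw [B_succ hd0]
  have hr := prod_ratio_le hd0 q
  have hmono : Real.exp (-(((d : ℝ) - 1) / (2 * ((q : ℝ) + 1)))) ≤ Real.exp (-(2 : ℝ) / ((q : ℝ) + 1)) := by
    apply Real.exp_le_exp.2
    have hq : (0 : ℝ) < (q : ℝ) + 1 := by positivity
    have hd' : (5 : ℝ) ≤ d := by exact_mod_cast hd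
    rw [neg_div, neg_le_neg_iff, div_le_div_iff₀ hq (by positivity)]
    nlinarith
  have key := (hr.trans hmono).trans (exp_le_ratio_sq q)
  have hq2 : (0 : ℝ) < ((q : ℝ) + 2) ^ 2 := by positivity
  calc B d q * (∏ j ∈ range d, (((q * d + (j + 1) : ℕ) : ℝ) / (((q + 1) * d : ℕ) : ℝ))) * ((q : ℝ) + 2) ^ 2
      ≤ B d q * ((((q : ℝ) + 1) / ((q : ℝ) + 2)) ^ 2) * ((q : ℝ) + 2) ^ 2 := by gcongr
    _ = B d q * ((q : ℝ) + 1) ^ 2 := by field_simp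

/-- **Decay of the balanced probability**: `B q · (q+1)² ≤ B q₀ · (q₀+1)²` for `q ≥ q₀` (`d ≥ 5`). -/
theorem B_decay (hd : 5 ≤ d) {q₀ q : ℕ} (h : q₀ ≤ q) :
    B d q * ((q : ℝ) + 1) ^ 2 ≤ B d q₀ * ((q₀ : ℝ) + 1) ^ 2 := by
  induction q, h using Nat.le_induction with
  | base => exact le_rfl
  | succ q _ ih =>
    have := B_step hd q
    push_cast at this ⊢
    have e : (q : ℝ) + 1 + 1 = (q : ℝ) + 2 := by ring
    rw [e]
    exact this.trans ih

/-! ### The tail sum -/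

/-- One block of `d` consecutive terms: `Σ_{k ∈ [Qd, Qd+d)} u k ≤ d · B Q`. -/
theorem sum_block_le (hd : 0 < d) (Q : ℕ) : ∑ k ∈ Ico (Q * d) (Q * d + d), u d k ≤ d * B d Q := by
  calc ∑ k ∈ Ico (Q * d) (Q * d + d), u d k ≤ ∑ _k ∈ Ico (Q * d) (Q * d + d), B d Q := by
        refine Finset.sum_le_sum fun k hk => ?_
        exact (u_antitone hd (mem_Ico.1 hk).1).trans (u_mul_le_B hd Q)
    _ = d * B d Q := by rw [Finset.sum_const, Nat.card_Ico, Nat.add_sub_cancel_left, nsmul_eq_mul]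

/-- The tail up to a multiple of `d`, telescoped. -/
theorem sum_Ico_le (hd : 5 ≤ d) {q₀ : ℕ} (hq₀ : 1 ≤ q₀) {Q : ℕ} (hQ : q₀ ≤ Q) :
    ∑ k ∈ Ico (q₀ * d) (Q * d), u d k ≤ d * B d q₀ * ((q₀ : ℝ) + 1) ^ 2 * (1 / q₀ - 1 / Q) := by
  have hd0 : 0 < d := by omega
  induction Q, hQ using Nat.le_induction with
  | base => simp
  | succ Q hQ ih =>
    have hQpos : (0 : ℝ) < Q := by exact_mod_cast (lt_of_lt_of_le hq₀ hQ)
    rw [← Finset.sum_Ico_consecutive _ (Nat.mul_le_mul_right d hQ) (by nlinarith : Q * d ≤ (Q + 1) * d)]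
    have hblock : ∑ k ∈ Ico (Q * d) ((Q + 1) * d), u d k ≤ d * B d q₀ * ((q₀ : ℝ) + 1) ^ 2 * (1 / Q - 1 / (Q + 1)) := by
      have e : (Q + 1) * d = Q * d + d := by ring
      rw [e]
      refine (sum_block_le hd0 Q).trans ?_
      have hdec := B_decay hd hQ
      have hdpos : (0 : ℝ) < d := by exact_mod_cast hd0
      -- `d B Q ≤ d B q₀ (q₀+1)² / (Q+1)² ≤ d B q₀ (q₀+1)² (1/Q - 1/(Q+1))`
      have h1 : B d Q ≤ B d q₀ * ((q₀ : ℝ) + 1) ^ 2 / ((Q : ℝ) + 1) ^ 2 := by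
        rw [le_div_iff₀ (by positivity)]; exact hdec
      have h2 : 1 / ((Q : ℝ) + 1) ^ 2 ≤ 1 / Q - 1 / ((Q : ℝ) + 1) := by
        rw [div_sub_div _ _ hQpos.ne' (by positivity), div_le_div_iff₀ (by positivity) (by positivity)]
        nlinarith
      have hBq₀ := B_pos hd0 q₀
      calc (d : ℝ) * B d Q ≤ d * (B d q₀ * ((q₀ : ℝ) + 1) ^ 2 / ((Q : ℝ) + 1) ^ 2) := by gcongr
        _ = d * B d q₀ * ((q₀ : ℝ) + 1) ^ 2 * (1 / ((Q : ℝ) + 1) ^ 2) := by ring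
        _ ≤ d * B d q₀ * ((q₀ : ℝ) + 1) ^ 2 * (1 / Q - 1 / ((Q : ℝ) + 1)) := by gcongr
    push_cast
    linarith [ih, hblock]

/-- **The Green's-function bound**: for `d ≥ 5`, `q₀ ≥ 1` and every `N`,
`Σ_{k<N} u d k ≤ Σ_{k<q₀d} u d k + d · B d q₀ · (q₀+1)² / q₀`. -/
theorem sum_range_u_le (hd : 5 ≤ d) {q₀ : ℕ} (hq₀ : 1 ≤ q₀) (N : ℕ) :
    ∑ k ∈ range N, u d k ≤ ∑ k ∈ range (q₀ * d), u d k + d * B d q₀ * ((q₀ : ℝ) + 1) ^ 2 / q₀ := by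
  have hd0 : 0 < d := by omega
  set Q := max q₀ N with hQdef
  have hQ : q₀ ≤ Q := le_max_left _ _
  have hN : N ≤ Q * d := (le_max_right q₀ N).trans (Nat.le_mul_of_pos_right Q hd0)
  calc ∑ k ∈ range N, u d k ≤ ∑ k ∈ range (Q * d), u d k :=
        Finset.sum_le_sum_of_subset_of_nonneg (range_subset_range.2 hN) fun k _ _ => u_nonneg k
    _ = ∑ k ∈ range (q₀ * d), u d k + ∑ k ∈ Ico (q₀ * d) (Q * d), u d k := by
        rw [Finset.range_eq_Ico, Finset.range_eq_Ico,
          Finset.sum_Ico_consecutive _ (Nat.zero_le _) (Nat.mul_le_mul_right d hQ)]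
    _ ≤ ∑ k ∈ range (q₀ * d), u d k + d * B d q₀ * ((q₀ : ℝ) + 1) ^ 2 * (1 / q₀ - 1 / Q) := by
        gcongr; exact sum_Ico_le hd hq₀ hQ
    _ ≤ ∑ k ∈ range (q₀ * d), u d k + d * B d q₀ * ((q₀ : ℝ) + 1) ^ 2 / q₀ := by
        have hB := B_pos hd0 q₀
        have hdpos : (0 : ℝ) < d := by exact_mod_cast hd0
        have hQpos : (0 : ℝ) < Q := by exact_mod_cast lt_of_lt_of_le hq₀ hQ
        have hX : 0 ≤ (d : ℝ) * B d q₀ * ((q₀ : ℝ) + 1) ^ 2 := by positivity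
        have h1 : (d : ℝ) * B d q₀ * ((q₀ : ℝ) + 1) ^ 2 * (1 / q₀ - 1 / Q) =
            d * B d q₀ * ((q₀ : ℝ) + 1) ^ 2 / q₀ - d * B d q₀ * ((q₀ : ℝ) + 1) ^ 2 * (1 / Q) := by ring
        have h2 : 0 ≤ (d : ℝ) * B d q₀ * ((q₀ : ℝ) + 1) ^ 2 * (1 / Q) := mul_nonneg hX (one_div_pos.2 hQpos).le
        linarith

/-- **The explicit Green's-function bound** `G⁺(d, q₀) = Σ_{k<q₀d} Mrec d k / d^{2k} + d · B d q₀ · (q₀+1)² / q₀`. -/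
def Gplus (d q₀ : ℕ) : ℝ :=
  ∑ k ∈ range (q₀ * d), (Mrec d k : ℝ) / (d : ℝ) ^ (2 * k) + d * B d q₀ * ((q₀ : ℝ) + 1) ^ 2 / q₀

/-- **`Σ_{k<N} u d k ≤ G⁺(d, q₀)`** for every `N` (`d ≥ 5`, `q₀ ≥ 1`). -/
theorem sum_u_le_Gplus (hd : 5 ≤ d) {q₀ : ℕ} (hq₀ : 1 ≤ q₀) (N : ℕ) : ∑ k ∈ range N, u d k ≤ Gplus d q₀ := by
  have h := sum_range_u_le hd hq₀ N
  unfold Gplus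
  simp_rw [← u_eq_Mrec]
  exact h

end Summit.CriticalPhenomena.PercolationContinuityZ3.Theorems.Pcint.OSM

end
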